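import Summits.KontsevichZagierPeriods.KontsevichZagierPeriods.Theorems.HurwitzMicroSectorsNormalFormPrincipleEZConstPow
import Summits.KontsevichZagierPeriods.KontsevichZagierPeriods.Theorems.HurwitzMicroSectorsNormalFormPrincipleEZConstBoxPred
import Summits.KontsevichZagierPeriods.KontsevichZagierPeriods.Theorems.HurwitzMicroSectorsNormalFormPrincipleEZExistsBoxes
import Summits.KontsevichZagierPeriods.KontsevichZagierPeriods.Theorems.HurwitzMicroSectorsNormalFormPrincipleEZValueKit
import Summits.KontsevichZagierPeriods.KontsevichZagierPeriods.Theorems.HurwitzMicroSectorsNormalFormPrincipleEZRigid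
import Summits.KontsevichZagierPeriods.KontsevichZagierPeriods.Theorems.HurwitzMicroSectorsNormalFormPrincipleAlgCarriers
import Summits.KontsevichZagierPeriods.KontsevichZagierPeriods.Theorems.HurwitzMicroSectorsNormalFormPrincipleNfPoleOneK22
import Summits.KontsevichZagierPeriods.KontsevichZagierPeriods.Theorems.HurwitzMicroSectorsNormalFormPrincipleAlgLevelOneReduction

/-!
# `NormalFormPrinciple` (stmt-KontsevichZagierPeriods-3869), line `SketchIdeator1` — leaf `stub_boxRigidity`:
# THE EVEN ZETA VALUES LAYER, I: reduction to the normal form `[pt, q] + Σ_k [(0,1)^{2k}, β_k/(1 − Πxₗ)]`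

Diagonal level-one boxes of EVEN weight `[(0,1)^{2k}, P(x₀⋯x_{2k−1})/(1 − x₀⋯x_{2k−1})]` with
`P ∈ (ℚ̄ ∩ ℝ)[t]` (value `q + β ζ(2k)`), constant boxes `[(0,1)^w, c]` and algebraic points. Moves, all
inside `FormalRep ⧸ relations`: `t^m/(1−t) = 1/(1−t) − Σ_{i<m} tⁱ` (rule 1); the power chart
`xₗ ↦ xₗ^{i+1}` applied to a constant turns the monomial box `[(0,1)^w, c tⁱ]` into `[(0,1)^w, c/(i+1)^w]`
(rule 2, `constPow_substitution`); a constant box loses one dimension at a time down to the point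
(rule 3, `constBox_sub_pred`). The normal form is kept in the class group `FormalRep ⧸ relations` with
the carrier families `[pt, q]` (`Dlog.exists_ptCarrierA`) and `[(0,1)^{2(k+1)}, β/(1 − Πxₗ)]`
(`exists_zetaCarrier`), additive in their algebraic coefficients. Part II (`…EvenZetaLayer`) is the
kernel theorem (Euler + Lindemann). [cite: KontsevichZagier2001, §1.2] No new definitions.
-/

noncomputable section

open MeasureTheory Set
open Literature.NumberTheory.Transcendental Literature.NumberTheory.Transcendental.KZ
open Literature.ModelTheory.ExponentialFields (IsSemialgebraic)

namespace Summit.KontsevichZagierPeriods.HurwitzMicroSectors.NormalFormPrinciple.PiBox.EvenZeta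


open Summit.KontsevichZagierPeriods.HurwitzMicroSectors.NormalFormPrinciple.PiBox.Dlog
  (pt_add_mem_relations pt_zero_mem_relations pt_congr_mem_relations exists_ptCarrierA)
open Summit.KontsevichZagierPeriods.HurwitzMicroSectors.NormalFormPrinciple.PiBox.AlgLevelOne
  (isAlgebraic_add' isAlgebraic_neg')
open Summit.KontsevichZagierPeriods.HurwitzMicroSectors.NormalFormPrinciple.PiBox.Dlog.K22 (mk_eq_mk_of_sub_mem)

/-- `c·q` is algebraic for algebraic `c` and rational `q`. [folklore] -/
theorem ez_isAlgebraic_mul_ratCast {c : ℝ} (hc : IsAlgebraic ℚ c) (q : ℚ) : IsAlgebraic ℚ (c * (q : ℝ)) :=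
  isAlgebraic_iff_isIntegral.2 ((isAlgebraic_iff_isIntegral.1 hc).mul (isIntegral_algebraMap (x := q)))

/-- **A constant box collapses to the point** `[pt, c]` (rule 3, `w` times). [cite: KontsevichZagier2001, §1.2] -/
theorem constBox_sub_pt (c : ℝ) (hc : IsAlgebraic ℚ c) : ∀ (w : ℕ) (N : IntegralRep w) (Z : IntegralRep 0),
    N.domain = {x | ∀ i, x i ∈ Set.Ioo (0:ℝ) 1} → EqOn N.integrand (fun _ => c) N.domain →
    Z.domain = Set.univ → (Z.integrand = fun _ => c) → of N - of Z ∈ relations := by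
  intro w
  induction w with
  | zero =>
    intro N Z hNd hNi hZd hZi
    refine of_sub_of_mem_relations_of_eqOn (by rw [hZd, hNd]; ext x; simp) fun x hx => ?_
    rw [hNi hx, hZi]
  | succ n ih =>
    intro N Z hNd hNi hZd hZi
    obtain ⟨hexC, -, -⟩ := exists_boxes c hc
    obtain ⟨N', hN'd, hN'i⟩ := hexC n
    have e1 := constBox_sub_pred n c hc N N' hNd hNi hN'd (hN'i ▸ fun _ _ => rfl)
    have e2 := ih N' Z hN'd (hN'i ▸ fun _ _ => rfl) hZd hZi
    have e : of N - of Z = (of N - of N') + (of N' - of Z) := by abel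
    rw [e]
    exact relations.add_mem e1 e2

/-- **A diagonal monomial box is an algebraic point**: `[(0,1)^w, c (Πxₗ)^i] ≡ [pt, c/(i+1)^w]`
(rule 2: the power chart `xₗ ↦ xₗ^{i+1}` applied to the constant `c/(i+1)^w`, then rule 3).
[cite: KontsevichZagier2001, §1.2] -/
theorem monomialBox_sub_pt (c : ℝ) (hc : IsAlgebraic ℚ c) (w i : ℕ) (M : IntegralRep w) (Z : IntegralRep 0)
    (hMd : M.domain = {x | ∀ i, x i ∈ Set.Ioo (0:ℝ) 1})
    (hMi : EqOn M.integrand (fun x => c * (∏ l, x l) ^ i) M.domain)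
    (hZd : Z.domain = Set.univ) (hZi : Z.integrand = fun _ => c / (((i + 1) ^ w : ℕ) : ℝ)) :
    of M - of Z ∈ relations := by
  have hc' : IsAlgebraic ℚ (c / (((i + 1) ^ w : ℕ) : ℝ)) := by
    have e : c / (((i + 1) ^ w : ℕ) : ℝ) = c * ((1 / ((i + 1) ^ w : ℕ) : ℚ) : ℝ) := by push_cast; ring
    rw [e]; exact ez_isAlgebraic_mul_ratCast hc _
  obtain ⟨hexC, -, -⟩ := exists_boxes _ hc'
  obtain ⟨N', hN'd, hN'i⟩ := hexC w
  have hpos : ((((i + 1) ^ w : ℕ)) : ℝ) ≠ 0 := by positivity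
  have e1 := constPow_substitution w (i + 1) (Nat.succ_pos i) _ hc' M N' hMd (fun x hx => by
    rw [hMi hx]
    beta_reduce
    rw [Nat.add_sub_cancel, Finset.prod_pow]
    field_simp) hN'd (hN'i ▸ fun _ _ => rfl)
  have e2 := constBox_sub_pt _ hc' w N' Z hN'd (hN'i ▸ fun _ _ => rfl) hZd hZi
  have e : of M - of Z = (of M - of N') + (of N' - of Z) := by abel
  rw [e]
  exact relations.add_mem e1 e2

/-- **Normal form of a diagonal monomial zeta box** `[(0,1)^w, c (Πxₗ)^m/(1 − Πxₗ)]` (`w ≥ 2`):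
`[(0,1)^w, c/(1 − Πxₗ)] + [pt, −c Σ_{i<m} 1/(i+1)^w]` (`t^m/(1−t) = 1/(1−t) − Σ_{i<m} t^i`, rule 1; the
monomials are points). [cite: KontsevichZagier2001, §1.2] -/
theorem diagMonomial_normalForm (c : ℝ) (hc : IsAlgebraic ℚ c) (w : ℕ) (hw : 2 ≤ w) (m : ℕ)
    (N B : IntegralRep w) (Z : IntegralRep 0)
    (hNd : N.domain = {x | ∀ i, x i ∈ Set.Ioo (0:ℝ) 1})
    (hNi : EqOn N.integrand (fun x => c * (∏ l, x l) ^ m / (1 - ∏ l, x l)) N.domain)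
    (hBd : B.domain = {x | ∀ i, x i ∈ Set.Ioo (0:ℝ) 1})
    (hBi : EqOn B.integrand (fun x => c * (∏ l, x l) ^ 0 / (1 - ∏ l, x l)) B.domain)
    (hZd : Z.domain = Set.univ)
    (hZi : Z.integrand = fun _ => -(∑ i ∈ Finset.range m, c / (((i + 1) ^ w : ℕ) : ℝ))) :
    of N - of B - of Z ∈ relations := by
  classical
  obtain ⟨Zf, hZf⟩ := exists_ptCarrierA
  obtain ⟨-, hexM, -⟩ := exists_boxes c hc
  have hM : ∀ i : ℕ, ∃ M : IntegralRep w, M.domain = {x | ∀ i, x i ∈ Set.Ioo (0:ℝ) 1} ∧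
      M.integrand = fun x => c * (∏ l, x l) ^ i := fun i => hexM w i
  choose M hMd hMi using hM
  -- `B = N + Σ_{i<m} M_i`
  have esum : of B - of N - ∑ i : Fin m, of (M i) ∈ relations := by
    refine of_sub_of_sub_sum_mem_relations m B N (fun i => M i) (hNd.trans hBd.symm)
      (fun i => (hMd i).trans hBd.symm) fun x hx => ?_
    rw [hBd] at hx
    have hw0 : w ≠ 0 := by omega
    have ht := BoxIntegral.prod_mem_Ioo hw0 hx
    have ht1 : (1:ℝ) - ∏ l, x l ≠ 0 := by linarith [ht.2]
    show B.integrand x = N.integrand x + ∑ i : Fin m, (M i).integrand x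
    rw [hBi (hBd ▸ hx), hNi (hNd ▸ hx), Fin.sum_univ_eq_sum_range (fun i => (M i).integrand x) m]
    simp only [hMi, pow_zero]
    have hS : ∑ i ∈ Finset.range m, (∏ l, x l) ^ i = (1 - (∏ l, x l) ^ m) / (1 - ∏ l, x l) := by
      rw [eq_div_iff ht1]
      exact geom_sum_mul_neg (∏ l, x l) m
    rw [← Finset.mul_sum, hS]
    field_simp
    ring
  -- each `M_i` is the point `c/(i+1)^w`
  have halg : ∀ i : ℕ, IsAlgebraic ℚ (c / (((i + 1) ^ w : ℕ) : ℝ)) := fun i => by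
    have e : c / (((i + 1) ^ w : ℕ) : ℝ) = c * ((1 / ((i + 1) ^ w : ℕ) : ℚ) : ℝ) := by push_cast; ring
    rw [e]; exact ez_isAlgebraic_mul_ratCast hc _
  have ept : ∀ i : ℕ, of (M i) - of (Zf (c / (((i + 1) ^ w : ℕ) : ℝ))) ∈ relations := fun i =>
    monomialBox_sub_pt c hc w i (M i) _ (hMd i) ((hMi i) ▸ fun _ _ => rfl) (hZf _ (halg i)).1
      (hZf _ (halg i)).2
  -- the sum of the points
  have hq : ∀ n : ℕ, IsAlgebraic ℚ (∑ i ∈ Finset.range n, c / (((i + 1) ^ w : ℕ) : ℝ)) := by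
    intro n
    induction n with
    | zero => simpa using isAlgebraic_zero
    | succ n ih => rw [Finset.sum_range_succ]; exact isAlgebraic_add' ih (halg n)
  have esumpt : ∀ n : ℕ, of (Zf (∑ i ∈ Finset.range n, c / (((i + 1) ^ w : ℕ) : ℝ))) -
      ∑ i ∈ Finset.range n, of (Zf (c / (((i + 1) ^ w : ℕ) : ℝ))) ∈ relations := by
    intro n
    induction n with
    | zero =>
      simp only [Finset.range_zero, Finset.sum_empty, sub_zero]
      exact pt_zero_mem_relations _ (hZf 0 isAlgebraic_zero).2
    | succ n ih =>
      have eadd := pt_add_mem_relations (Zf (∑ i ∈ Finset.range (n + 1), c / (((i + 1) ^ w : ℕ) : ℝ)))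
        (Zf (∑ i ∈ Finset.range n, c / (((i + 1) ^ w : ℕ) : ℝ))) (Zf (c / (((n + 1) ^ w : ℕ) : ℝ)))
        (hZf _ (hq (n + 1))).1 (hZf _ (hq n)).1 (hZf _ (halg n)).1
        (by rw [(hZf _ (hq (n + 1))).2, Finset.sum_range_succ]) (hZf _ (hq n)).2 (hZf _ (halg n)).2
      have hs : ∑ i ∈ Finset.range (n + 1), of (Zf (c / (((i + 1) ^ w : ℕ) : ℝ))) =
          ∑ i ∈ Finset.range n, of (Zf (c / (((i + 1) ^ w : ℕ) : ℝ))) +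
            of (Zf (c / (((n + 1) ^ w : ℕ) : ℝ))) := Finset.sum_range_succ _ _
      rw [hs]
      have e : of (Zf (∑ i ∈ Finset.range (n + 1), c / (((i + 1) ^ w : ℕ) : ℝ))) -
          (∑ i ∈ Finset.range n, of (Zf (c / (((i + 1) ^ w : ℕ) : ℝ))) +
            of (Zf (c / (((n + 1) ^ w : ℕ) : ℝ)))) =
          (of (Zf (∑ i ∈ Finset.range (n + 1), c / (((i + 1) ^ w : ℕ) : ℝ))) -
            of (Zf (∑ i ∈ Finset.range n, c / (((i + 1) ^ w : ℕ) : ℝ))) -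
            of (Zf (c / (((n + 1) ^ w : ℕ) : ℝ)))) +
          (of (Zf (∑ i ∈ Finset.range n, c / (((i + 1) ^ w : ℕ) : ℝ))) -
            ∑ i ∈ Finset.range n, of (Zf (c / (((i + 1) ^ w : ℕ) : ℝ)))) := by abel
      rw [e]
      exact relations.add_mem eadd ih
  -- `Z ≡ −(sum of points)`
  have eZ : of (Zf 0) - of Z - of (Zf (∑ i ∈ Finset.range m, c / (((i + 1) ^ w : ℕ) : ℝ))) ∈ relations :=
    pt_add_mem_relations (Zf 0) Z (Zf _) (hZf 0 isAlgebraic_zero).1 hZd (hZf _ (hq m)).1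
      (by rw [(hZf 0 isAlgebraic_zero).2]; funext; ring) hZi (hZf _ (hq m)).2
  have eZ0 : of (Zf 0) ∈ relations := pt_zero_mem_relations _ (hZf 0 isAlgebraic_zero).2
  have eM : ∑ i : Fin m, of (M i) - ∑ i ∈ Finset.range m, of (Zf (c / (((i + 1) ^ w : ℕ) : ℝ))) ∈
      relations := by
    rw [Fin.sum_univ_eq_sum_range (fun i => of (M i)) m, ← Finset.sum_sub_distrib]
    exact AddSubgroup.sum_mem _ fun i _ => ept i
  have e : of N - of B - of Z = -(of B - of N - ∑ i : Fin m, of (M i))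
      - (∑ i : Fin m, of (M i) - ∑ i ∈ Finset.range m, of (Zf (c / (((i + 1) ^ w : ℕ) : ℝ))))
      + (of (Zf (∑ i ∈ Finset.range m, c / (((i + 1) ^ w : ℕ) : ℝ))) -
          ∑ i ∈ Finset.range m, of (Zf (c / (((i + 1) ^ w : ℕ) : ℝ))))
      + (of (Zf 0) - of Z - of (Zf (∑ i ∈ Finset.range m, c / (((i + 1) ^ w : ℕ) : ℝ)))) - of (Zf 0) := by
    abel
  rw [e]
  exact relations.sub_mem (relations.add_mem (relations.add_mem (relations.sub_mem
    (relations.neg_mem esum) eM) (esumpt m)) eZ) eZ0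

/-! ## The zeta carriers and the normal form in `FormalRep ⧸ relations` -/

/-- **A family of zeta boxes** `Bf k c = [(0,1)^{2(k+1)}, c/(1 − Πxₗ)]` for real-algebraic `c` (junk
otherwise). [cite: KontsevichZagier2001, §1.1] -/
theorem exists_zetaCarrier : ∃ Bf : (k : ℕ) → ℝ → IntegralRep (2 * (k + 1)), ∀ k c, IsAlgebraic ℚ c →
    (Bf k c).domain = {x | ∀ i, x i ∈ Set.Ioo (0:ℝ) 1} ∧
      ((Bf k c).integrand = fun x => c * (∏ l, x l) ^ 0 / (1 - ∏ l, x l)) := by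
  classical
  refine ⟨fun k c => if h : IsAlgebraic ℚ c then
    Classical.choose ((exists_boxes c h).2.2 (2 * (k + 1)) 0 (by omega)) else IntegralRep.empty _,
    fun k c hc => ?_⟩
  simp only [dif_pos hc]
  exact Classical.choose_spec ((exists_boxes c hc).2.2 (2 * (k + 1)) 0 (by omega))

/-- A zeta box with zero coefficient is a relation. [cite: KontsevichZagier2001, §1.2 rule (1)] -/
theorem zetaCarrier_zero (Bf : (k : ℕ) → ℝ → IntegralRep (2 * (k + 1)))
    (hBf : ∀ k c, IsAlgebraic ℚ c → (Bf k c).domain = {x | ∀ i, x i ∈ Set.Ioo (0:ℝ) 1} ∧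
      ((Bf k c).integrand = fun x => c * (∏ l, x l) ^ 0 / (1 - ∏ l, x l))) (k : ℕ) : QuotientAddGroup.mk' relations (of (Bf k 0)) = 0 := by
  rw [QuotientAddGroup.mk'_apply, QuotientAddGroup.eq_zero_iff]
  exact of_mem_relations_of_eqOn_zero _ fun x _ => by rw [(hBf k 0 isAlgebraic_zero).2]; simp

/-- **Additivity of the zeta carriers in the coefficient** (rule 1). [cite: KontsevichZagier2001, §1.2 rule (1)] -/
theorem zetaCarrier_add (Bf : (k : ℕ) → ℝ → IntegralRep (2 * (k + 1)))
    (hBf : ∀ k c, IsAlgebraic ℚ c → (Bf k c).domain = {x | ∀ i, x i ∈ Set.Ioo (0:ℝ) 1} ∧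
      ((Bf k c).integrand = fun x => c * (∏ l, x l) ^ 0 / (1 - ∏ l, x l))) (k : ℕ) {a b : ℝ} (ha : IsAlgebraic ℚ a) (hb : IsAlgebraic ℚ b) :
    QuotientAddGroup.mk' relations (of (Bf k (a + b))) =
      QuotientAddGroup.mk' relations (of (Bf k a)) + QuotientAddGroup.mk' relations (of (Bf k b)) := by
  rw [← map_add]
  refine mk_eq_mk_of_sub_mem ?_
  have e : of (Bf k (a + b)) - (of (Bf k a) + of (Bf k b)) = of (Bf k (a + b)) - of (Bf k a) - of (Bf k b) := by
    abel
  rw [e]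
  obtain ⟨hd, hi⟩ := hBf k (a + b) (isAlgebraic_add' ha hb)
  obtain ⟨hda, hia⟩ := hBf k a ha
  obtain ⟨hdb, hib⟩ := hBf k b hb
  refine integrandAddRel_subset_relations ⟨_, _, _, _, hda.trans hd.symm, hdb.trans hd.symm, fun x _ => ?_, rfl⟩
  rw [Pi.add_apply, hi, hia, hib]
  ring

/-- The point carriers are additive in the class group. [cite: KontsevichZagier2001, §1.2 rule (1)] -/
theorem ptCarrier_add (Zf : ℝ → IntegralRep 0) (hZf : ∀ r, IsAlgebraic ℚ r → (Zf r).domain = Set.univ ∧ ((Zf r).integrand = fun _ => r)) {a b : ℝ} (ha : IsAlgebraic ℚ a) (hb : IsAlgebraic ℚ b) :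
    QuotientAddGroup.mk' relations (of (Zf (a + b))) =
      QuotientAddGroup.mk' relations (of (Zf a)) + QuotientAddGroup.mk' relations (of (Zf b)) := by
  rw [← map_add]
  refine mk_eq_mk_of_sub_mem ?_
  have e : of (Zf (a + b)) - (of (Zf a) + of (Zf b)) = of (Zf (a + b)) - of (Zf a) - of (Zf b) := by abel
  rw [e]
  exact pt_add_mem_relations _ _ _ (hZf _ (isAlgebraic_add' ha hb)).1 (hZf a ha).1 (hZf b hb).1
    (hZf _ (isAlgebraic_add' ha hb)).2 (hZf a ha).2 (hZf b hb).2

/-- The zero point carrier is trivial. [cite: KontsevichZagier2001, §1.2 rule (1)] -/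
theorem ptCarrier_zero (Zf : ℝ → IntegralRep 0) (hZf : ∀ r, IsAlgebraic ℚ r → (Zf r).domain = Set.univ ∧ ((Zf r).integrand = fun _ => r)) : QuotientAddGroup.mk' relations (of (Zf 0)) = 0 := by
  rw [QuotientAddGroup.mk'_apply, QuotientAddGroup.eq_zero_iff]
  exact pt_zero_mem_relations _ (hZf 0 isAlgebraic_zero).2

/-- **Normal forms are closed under addition.** [cite: KontsevichZagier2001, §1.2 rule (1)] -/
theorem nf_add (Zf : ℝ → IntegralRep 0) (hZf : ∀ r, IsAlgebraic ℚ r → (Zf r).domain = Set.univ ∧ ((Zf r).integrand = fun _ => r))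
    (Bf : (k : ℕ) → ℝ → IntegralRep (2 * (k + 1)))
    (hBf : ∀ k c, IsAlgebraic ℚ c → (Bf k c).domain = {x | ∀ i, x i ∈ Set.Ioo (0:ℝ) 1} ∧
      ((Bf k c).integrand = fun x => c * (∏ l, x l) ^ 0 / (1 - ∏ l, x l))) {x y : FormalRep}
    (hx : ∃ (q : ℝ) (T : Finset ℕ) (β : ℕ → ℝ), IsAlgebraic ℚ q ∧ (∀ k ∈ T, IsAlgebraic ℚ (β k)) ∧
      QuotientAddGroup.mk' relations x =
        QuotientAddGroup.mk' relations (of (Zf q)) + ∑ k ∈ T, QuotientAddGroup.mk' relations (of (Bf k (β k))))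
    (hy : ∃ (q : ℝ) (T : Finset ℕ) (β : ℕ → ℝ), IsAlgebraic ℚ q ∧ (∀ k ∈ T, IsAlgebraic ℚ (β k)) ∧
      QuotientAddGroup.mk' relations y =
        QuotientAddGroup.mk' relations (of (Zf q)) + ∑ k ∈ T, QuotientAddGroup.mk' relations (of (Bf k (β k)))) :
    ∃ (q : ℝ) (T : Finset ℕ) (β : ℕ → ℝ), IsAlgebraic ℚ q ∧ (∀ k ∈ T, IsAlgebraic ℚ (β k)) ∧
      QuotientAddGroup.mk' relations (x + y) =
        QuotientAddGroup.mk' relations (of (Zf q)) + ∑ k ∈ T, QuotientAddGroup.mk' relations (of (Bf k (β k))) := by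
  classical
  obtain ⟨q, T, β, hq, hβ, ex⟩ := hx
  obtain ⟨q', T', β', hq', hβ', ey⟩ := hy
  refine ⟨q + q', T ∪ T', fun k => (if k ∈ T then β k else 0) + (if k ∈ T' then β' k else 0),
    isAlgebraic_add' hq hq', fun k _ => isAlgebraic_add' ?_ ?_, ?_⟩
  · split_ifs with h
    · exact hβ k h
    · exact isAlgebraic_zero
  · split_ifs with h
    · exact hβ' k h
    · exact isAlgebraic_zero
  have h1 : ∀ k, IsAlgebraic ℚ (if k ∈ T then β k else 0) := fun k => by
    split_ifs with h
    · exact hβ k h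
    · exact isAlgebraic_zero
  have h2 : ∀ k, IsAlgebraic ℚ (if k ∈ T' then β' k else 0) := fun k => by
    split_ifs with h
    · exact hβ' k h
    · exact isAlgebraic_zero
  have hs1 : ∑ k ∈ T, QuotientAddGroup.mk' relations (of (Bf k (β k))) =
      ∑ k ∈ T ∪ T', QuotientAddGroup.mk' relations (of (Bf k (if k ∈ T then β k else 0))) := by
    refine (Finset.sum_subset Finset.subset_union_left fun k _ hk => ?_).symm.trans ?_ |>.symm
    · rw [if_neg hk]; exact zetaCarrier_zero Bf hBf k
    · exact Finset.sum_congr rfl fun k hk => by rw [if_pos hk]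
  have hs2 : ∑ k ∈ T', QuotientAddGroup.mk' relations (of (Bf k (β' k))) =
      ∑ k ∈ T ∪ T', QuotientAddGroup.mk' relations (of (Bf k (if k ∈ T' then β' k else 0))) := by
    refine (Finset.sum_subset Finset.subset_union_right fun k _ hk => ?_).symm.trans ?_ |>.symm
    · rw [if_neg hk]; exact zetaCarrier_zero Bf hBf k
    · exact Finset.sum_congr rfl fun k hk => by rw [if_pos hk]
  rw [map_add, ex, ey, hs1, hs2, ptCarrier_add Zf hZf hq hq', Finset.sum_congr rfl fun k _ =>
    zetaCarrier_add Bf hBf k (h1 k) (h2 k), Finset.sum_add_distrib]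
  abel

/-- **Normal forms are closed under negation.** [cite: KontsevichZagier2001, §1.2 rule (1)] -/
theorem nf_neg (Zf : ℝ → IntegralRep 0) (hZf : ∀ r, IsAlgebraic ℚ r → (Zf r).domain = Set.univ ∧ ((Zf r).integrand = fun _ => r))
    (Bf : (k : ℕ) → ℝ → IntegralRep (2 * (k + 1)))
    (hBf : ∀ k c, IsAlgebraic ℚ c → (Bf k c).domain = {x | ∀ i, x i ∈ Set.Ioo (0:ℝ) 1} ∧
      ((Bf k c).integrand = fun x => c * (∏ l, x l) ^ 0 / (1 - ∏ l, x l))) {x : FormalRep}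
    (hx : ∃ (q : ℝ) (T : Finset ℕ) (β : ℕ → ℝ), IsAlgebraic ℚ q ∧ (∀ k ∈ T, IsAlgebraic ℚ (β k)) ∧
      QuotientAddGroup.mk' relations x =
        QuotientAddGroup.mk' relations (of (Zf q)) + ∑ k ∈ T, QuotientAddGroup.mk' relations (of (Bf k (β k)))) :
    ∃ (q : ℝ) (T : Finset ℕ) (β : ℕ → ℝ), IsAlgebraic ℚ q ∧ (∀ k ∈ T, IsAlgebraic ℚ (β k)) ∧
      QuotientAddGroup.mk' relations (-x) =
        QuotientAddGroup.mk' relations (of (Zf q)) + ∑ k ∈ T, QuotientAddGroup.mk' relations (of (Bf k (β k))) := by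
  obtain ⟨q, T, β, hq, hβ, ex⟩ := hx
  refine ⟨-q, T, fun k => -β k, isAlgebraic_neg' hq, fun k hk => isAlgebraic_neg' (hβ k hk), ?_⟩
  have hZ : QuotientAddGroup.mk' relations (of (Zf (-q))) = -QuotientAddGroup.mk' relations (of (Zf q)) := by
    have h := ptCarrier_add Zf hZf hq (isAlgebraic_neg' hq)
    rw [add_neg_cancel, ptCarrier_zero Zf hZf] at h
    exact (neg_eq_of_add_eq_zero_right h.symm).symm
  have hB : ∀ k ∈ T, QuotientAddGroup.mk' relations (of (Bf k (-β k))) =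
      -QuotientAddGroup.mk' relations (of (Bf k (β k))) := fun k hk => by
    have h := zetaCarrier_add Bf hBf k (hβ k hk) (isAlgebraic_neg' (hβ k hk))
    rw [add_neg_cancel, zetaCarrier_zero Bf hBf] at h
    exact (neg_eq_of_add_eq_zero_right h.symm).symm
  rw [map_neg, ex, hZ, Finset.sum_congr rfl hB, Finset.sum_neg_distrib]
  abel

end Summit.KontsevichZagierPeriods.HurwitzMicroSectors.NormalFormPrinciple.PiBox.EvenZeta
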